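import Literature.MathematicalPhysics.QuantumLattice.HubbardUVSymbolMixedSmooth
import Literature.Analysis.Calculus.IteratedDifferenceBound
import HarnessLib

/-!
# Mixed differences `Δ_ω^a Δ_s^b Δ_t^c` of the ultraviolet symbol `Ψ₁(ω, E(s,t))` along a `C²` surface in the band variable:
# `‖·‖ ≤ h₀^a h^{b+c}·S_{a,b+c}(Λ,D)/max(|ω₀| - a h₀, Λ/2)^{1+a+min(b+c,1)}` for every time order `a` and `b, c ≤ 1`

Topic `MathematicalPhysics/QuantumLattice`; continues `HubbardUVSymbolMixedSmooth` (cell gate-hubbard-kl: the mixed partials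
`Φ_{a,m} = ∂_e^m∂_ω^a Ψ₁` of the normalised symbol `Ψ₁ = w_Λ·(-iω+e)⁻¹` of the covariance above scale `Λ` and their envelopes
`C_{a,m}(Λ)/max(|ω|,Λ/2)^{a+m+1}`).  Here the symbol is composed with a SURFACE `E(s,t)` in the band variable — two lattice directions
`s e_l + t e_{l'}` of a dispersion relation `e_K` through a base momentum, with `|E_s|, |E_t|, |E_{st}| ≤ D` — and DIFFERENCED: in the
frequency with step `h₀` (`= 2π/β` on the Matsubara grid) `a` times, in `s` and `t` with step `h` (`= 2π/L`) `b, c ≤ 1` times (so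
`l = l'` gives the pure second space difference).  By the iterated mean value inequality (`IteratedDifferenceBound`: the `k`-th
`ω`-derivative of the space differences of `Φ_{0,0}(ω,E)` is the same space difference of `Φ_{k,0}(ω,E)`), then one mean value per space
difference with the chain/product rule `∂_s∂_t Φ(E) = Φ″(E)E_sE_t + Φ′(E)E_{st}`:
`‖Δ_{h₀}^a Δ_h^b Δ_h^c Ψ₁(ω, E(s,t))|_{(ω₀,0,0)}‖ ≤ h₀^a h^{b+c}·S_{a,b+c}/max(|ω₀| - a h₀, Λ/2)^{a+min(b+c,1)+1}` with
`S_{a,0} = C_{a,0}`, `S_{a,1} = D C_{a,1}`, `S_{a,2} = D C_{a,1} + D² C_{a,2}·(2/Λ)` — the continuum input of the `ℓ²` norms of the mixed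
differences of the padded scale-`0` symbol on the space-time dual torus (Benfatto–Giuliani–Mastropietro 2006, Lemma 2.2: first moments
of the propagator in every direction from differences in every dual direction).

* `uvSurfaceConst`, `uvSurfaceConst_nonneg`;
* **`norm_spaceDiff_uvMixedFn_le`** (fixed frequency, time order `a`, `b, c ≤ 1`);
* `hasDerivAt_fwdDiff_param`, `hasDerivAt_fwdDiff_iter_param` (`ω`-derivatives commute with parameter differences);
* **`norm_mixedDiff_uvSymbolOneFn_le`** (the export).

Everything is proved; `uvSurfaceConst` is the only definition; no named facts.

## Sources

G. Benfatto, A. Giuliani, V. Mastropietro, Ann. Henri Poincaré 7 (2006) 809–898, §2.1 (2.3), Lemma 2.2, (2.36aa), App. A1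
(`BenfattoGiulianiMastropietro2006`); M. Salmhofer, *Renormalization* (1999), §4.2.5 (4.70)–(4.71) (`Salmhofer1999`).
-/

noncomputable section

namespace Literature.MathematicalPhysics.QuantumLattice

open Literature.Probability.LatticeModels Set Complex Filter
open scoped _root_.Topology

/-! ### Mixed differences of `Ψ₁(ω, E(s,t))` along a `C²` surface in the band variable -/

/-- **The surface constants** `S_{a,0} = C_{a,0}`, `S_{a,1} = D·C_{a,1}`, `S_{a,2} = D·C_{a,1} + D²·C_{a,2}·(2/Λ)` (chain rule:
`∂_s∂_t Φ(E) = Φ″(E)E_sE_t + Φ′(E)E_{st}`, `|E_s|,|E_t|,|E_{st}| ≤ D`, one envelope factor traded for `2/Λ`).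
[cite: BenfattoGiulianiMastropietro2006, (2.36aa)] -/
def uvSurfaceConst (Λ D : ℝ) (a : ℕ) : ℕ → ℝ
  | 0 => uvMixedConst Λ a 0
  | 1 => D * uvMixedConst Λ a 1
  | _ + 2 => D * uvMixedConst Λ a 1 + D ^ 2 * uvMixedConst Λ a 2 * (2 / Λ)

section Surface

variable {Λ D : ℝ} {E Es Et Est : ℝ → ℝ → ℝ}

/-- `S_{a,m} ≥ 0` (`D ≥ 0`, `Λ > 0`). [cite: BenfattoGiulianiMastropietro2006, (2.36aa)] -/
theorem uvSurfaceConst_nonneg (hΛ : 0 < Λ) (hD : 0 ≤ D) (a m : ℕ) : 0 ≤ uvSurfaceConst Λ D a m := by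
  have h0 := uvMixedConst_nonneg Λ a 0
  have h1 := uvMixedConst_nonneg Λ a 1
  have h2 := uvMixedConst_nonneg Λ a 2
  match m with
  | 0 => exact h0
  | 1 => exact mul_nonneg hD h1
  | _ + 2 => simp only [uvSurfaceConst]; positivity

/-- **Space differences at fixed frequency**: for a surface `E(s,t)` with `|E_s|, |E_t|, |E_{st}| ≤ D` and `b, c ≤ 1`,
`‖Δ_h^b Δ_h^c Φ_{a,0}(ω, E(·,·))|_{(0,0)}‖ ≤ h^{b+c}·S_{a,b+c}/max(|ω|,Λ/2)^{a+min(b+c,1)+1}` (mean value inequality once per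
difference; chain and product rule). [cite: BenfattoGiulianiMastropietro2006, (2.36aa)] -/
theorem norm_spaceDiff_uvMixedFn_le (hΛ : 0 < Λ) (hD : 0 ≤ D)
    (hEs : ∀ s t, HasDerivAt (fun s' => E s' t) (Es s t) s) (hEt : ∀ s t, HasDerivAt (fun t' => E s t') (Et s t) t)
    (hEst : ∀ s t, HasDerivAt (fun t' => Es s t') (Est s t) t)
    (bEs : ∀ s t, |Es s t| ≤ D) (bEt : ∀ s t, |Et s t| ≤ D) (bEst : ∀ s t, |Est s t| ≤ D)
    (a : ℕ) {b c : ℕ} (hb : b ≤ 1) (hc : c ≤ 1) {h : ℝ} (hh : 0 ≤ h) (ω : ℝ) :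
    ‖(fwdDiff h)^[b] (fun s => (fwdDiff h)^[c] (fun t => uvMixedFn Λ a 0 (ω, E s t)) 0) 0‖ ≤
      h ^ (b + c) * (uvSurfaceConst Λ D a (b + c) / max |ω| (Λ / 2) ^ (a + min (b + c) 1 + 1)) := by
  set m := max |ω| (Λ / 2) with hmdef
  have hm : 0 < m := uvEnv_pos hΛ ω
  have hC0 := uvMixedConst_nonneg Λ a 0
  have hC1 := uvMixedConst_nonneg Λ a 1
  have hC2 := uvMixedConst_nonneg Λ a 2
  -- the three envelopes at the fixed frequency
  have hΦ0 : ∀ e, ‖uvMixedFn Λ a 0 (ω, e)‖ ≤ uvMixedConst Λ a 0 / m ^ (a + 1) := fun e => by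
    simpa using norm_uvMixedFn_le hΛ a 0 ω e
  have hΦ1 : ∀ e, ‖uvMixedFn Λ a 1 (ω, e)‖ ≤ uvMixedConst Λ a 1 / m ^ (a + 2) := fun e => norm_uvMixedFn_le hΛ a 1 ω e
  have hΦ2 : ∀ e, ‖uvMixedFn Λ a 2 (ω, e)‖ ≤ uvMixedConst Λ a 2 / m ^ (a + 3) := fun e => norm_uvMixedFn_le hΛ a 2 ω e
  -- derivatives along the surface
  have hd1 : ∀ e, HasDerivAt (fun e' => uvMixedFn Λ a 0 (ω, e')) (uvMixedFn Λ a 1 (ω, e)) e := fun e =>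
    hasDerivAt_uvMixedFn_snd hΛ a 0 ω e
  have hd2 : ∀ e, HasDerivAt (fun e' => uvMixedFn Λ a 1 (ω, e')) (uvMixedFn Λ a 2 (ω, e)) e := fun e =>
    hasDerivAt_uvMixedFn_snd hΛ a 1 ω e
  -- `s ↦ Φ(E(s,t))` and `t ↦ Φ(E(s,t))`
  have hDs : ∀ s t, HasDerivAt (fun s' => uvMixedFn Λ a 0 (ω, E s' t)) (Es s t • uvMixedFn Λ a 1 (ω, E s t)) s :=
    fun s t => by have := (hd1 (E s t)).scomp s (hEs s t); exact this
  have hDt : ∀ s t, HasDerivAt (fun t' => uvMixedFn Λ a 0 (ω, E s t')) (Et s t • uvMixedFn Λ a 1 (ω, E s t)) t :=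
    fun s t => by have := (hd1 (E s t)).scomp t (hEt s t); exact this
  -- `t ↦ E_s • Φ′(E)` (for the mixed case)
  have hDst : ∀ s t, HasDerivAt (fun t' => Es s t' • uvMixedFn Λ a 1 (ω, E s t'))
      (Es s t • (Et s t • uvMixedFn Λ a 2 (ω, E s t)) + Est s t • uvMixedFn Λ a 1 (ω, E s t)) t :=
    fun s t => by have := (hEst s t).smul ((hd2 (E s t)).scomp t (hEt s t)); exact this
  -- norms of the derivatives
  have hn1 : ∀ (r : ℝ) (e : ℝ), |r| ≤ D → ‖r • uvMixedFn Λ a 1 (ω, e)‖ ≤ D * uvMixedConst Λ a 1 / m ^ (a + 2) := by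
    intro r e hr
    rw [norm_smul, Real.norm_eq_abs, mul_div_assoc]
    exact mul_le_mul hr (hΦ1 e) (norm_nonneg _) hD
  have hn2 : ∀ s t, ‖Es s t • (Et s t • uvMixedFn Λ a 2 (ω, E s t)) + Est s t • uvMixedFn Λ a 1 (ω, E s t)‖ ≤
      (D * uvMixedConst Λ a 1 + D ^ 2 * uvMixedConst Λ a 2 * (2 / Λ)) / m ^ (a + 2) := by
    intro s t
    have h2 : ‖Es s t • (Et s t • uvMixedFn Λ a 2 (ω, E s t))‖ ≤ D * (D * (uvMixedConst Λ a 2 / m ^ (a + 3))) := by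
      rw [norm_smul, norm_smul, Real.norm_eq_abs, Real.norm_eq_abs]
      exact mul_le_mul (bEs s t) (mul_le_mul (bEt s t) (hΦ2 _) (norm_nonneg _) hD) (by positivity) hD
    have hmΛ : 1 / m ≤ 2 / Λ := by
      rw [div_le_div_iff₀ hm hΛ, one_mul]; linarith [le_max_right |ω| (Λ / 2)]
    have h3 : D * (D * (uvMixedConst Λ a 2 / m ^ (a + 3))) ≤ D ^ 2 * uvMixedConst Λ a 2 * (2 / Λ) / m ^ (a + 2) := by
      rw [show D * (D * (uvMixedConst Λ a 2 / m ^ (a + 3))) = D ^ 2 * uvMixedConst Λ a 2 * (1 / m) / m ^ (a + 2) by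
        field_simp; ring]
      exact div_le_div_of_nonneg_right (mul_le_mul_of_nonneg_left hmΛ (by positivity)) (by positivity)
    calc _ ≤ ‖Es s t • (Et s t • uvMixedFn Λ a 2 (ω, E s t))‖ + ‖Est s t • uvMixedFn Λ a 1 (ω, E s t)‖ := norm_add_le _ _
      _ ≤ D ^ 2 * uvMixedConst Λ a 2 * (2 / Λ) / m ^ (a + 2) + D * uvMixedConst Λ a 1 / m ^ (a + 2) :=
          add_le_add (h2.trans h3) (hn1 _ _ (bEst s t))
      _ = _ := by ring
  interval_cases b <;> interval_cases c
  · -- (0,0)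
    simpa [uvSurfaceConst] using hΦ0 (E 0 0)
  · -- (0,1): one difference in `t`
    simp only [Function.iterate_zero, id_eq, Function.iterate_one, zero_add, pow_one, Nat.min_self, uvSurfaceConst]
    have := Literature.Analysis.norm_sub_le_of_norm_deriv_le (f := fun t' => uvMixedFn Λ a 0 (ω, E 0 t')) (x := 0) hh
      (fun t _ => hDt 0 t) (fun t _ => hn1 _ _ (bEt 0 t))
    simpa [fwdDiff] using this
  · -- (1,0): one difference in `s`
    simp only [Function.iterate_zero, id_eq, Function.iterate_one, add_zero, pow_one, Nat.min_self, uvSurfaceConst]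
    have := Literature.Analysis.norm_sub_le_of_norm_deriv_le (f := fun s' => uvMixedFn Λ a 0 (ω, E s' 0)) (x := 0) hh
      (fun s _ => hDs s 0) (fun s _ => hn1 _ _ (bEs s 0))
    simpa [fwdDiff] using this
  · -- (1,1): the mixed difference
    simp only [Function.iterate_one, uvSurfaceConst, Nat.reduceAdd, show min 2 1 = 1 from rfl]
    -- `k(s) = Φ(E(s,0+h)) - Φ(E(s,0))` has derivative `Δ_t (E_s • Φ′(E))`
    set k : ℝ → ℂ := fun s => fwdDiff h (fun t => uvMixedFn Λ a 0 (ω, E s t)) 0 with hk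
    have hk' : ∀ s, HasDerivAt k (Es s (0 + h) • uvMixedFn Λ a 1 (ω, E s (0 + h)) - Es s 0 • uvMixedFn Λ a 1 (ω, E s 0)) s :=
      fun s => (hDs s (0 + h)).sub (hDs s 0)
    have hkB : ∀ s, ‖Es s (0 + h) • uvMixedFn Λ a 1 (ω, E s (0 + h)) - Es s 0 • uvMixedFn Λ a 1 (ω, E s 0)‖ ≤
        h * ((D * uvMixedConst Λ a 1 + D ^ 2 * uvMixedConst Λ a 2 * (2 / Λ)) / m ^ (a + 2)) := by
      intro s
      have := Literature.Analysis.norm_sub_le_of_norm_deriv_le (f := fun t' => Es s t' • uvMixedFn Λ a 1 (ω, E s t')) (x := 0) hh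
        (fun t _ => hDst s t) (fun t _ => hn2 s t)
      simpa using this
    have hmain := Literature.Analysis.norm_sub_le_of_norm_deriv_le (f := k) (x := 0) hh (fun s _ => hk' s) (fun s _ => hkB s)
    have hid : fwdDiff h k 0 = k (0 + h) - k 0 := rfl
    rw [hid]
    refine hmain.trans (le_of_eq ?_)
    ring

/-- `ω`-derivatives commute with differences in a parameter: one difference. [cite: BenfattoGiulianiMastropietro2006, (2.36aa)] -/
theorem hasDerivAt_fwdDiff_param {F F' : ℝ → ℝ → ℂ} {h ω₀ : ℝ} (hF : ∀ s, HasDerivAt (fun ω => F ω s) (F' ω₀ s) ω₀) (s : ℝ) :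
    HasDerivAt (fun ω => fwdDiff h (F ω) s) (fwdDiff h (F' ω₀) s) ω₀ :=
  (hF (s + h)).sub (hF s)

/-- `ω`-derivatives commute with differences in a parameter: iterated differences. [cite: BenfattoGiulianiMastropietro2006, (2.36aa)] -/
theorem hasDerivAt_fwdDiff_iter_param {h ω₀ : ℝ} (n : ℕ) :
    ∀ {F F' : ℝ → ℝ → ℂ}, (∀ s, HasDerivAt (fun ω => F ω s) (F' ω₀ s) ω₀) →
      ∀ s, HasDerivAt (fun ω => (fwdDiff h)^[n] (F ω) s) ((fwdDiff h)^[n] (F' ω₀) s) ω₀ := by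
  induction n with
  | zero => intro F F' hF s; simpa using hF s
  | succ n ih =>
    intro F F' hF s
    have h1 := ih (F := fun ω => fwdDiff h (F ω)) (F' := fun ω => fwdDiff h (F' ω)) (fun s => hasDerivAt_fwdDiff_param hF s) s
    simpa only [Function.iterate_succ_apply] using h1

/-- **Mixed differences of the normalised ultraviolet symbol along a `C²` surface in the band**: for every time order `a`, space
orders `b, c ≤ 1`, steps `h₀, h ≥ 0`,
`‖Δ_{h₀}^a Δ_h^b Δ_h^c Ψ₁(ω, E(s,t))|_{(ω₀,0,0)}‖ ≤ h₀^a h^{b+c} S_{a,b+c}(Λ,D)/max(|ω₀| - a h₀, Λ/2)^{a+min(b+c,1)+1}`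
(iterated mean value in `ω` — the `k`-th `ω`-derivative of the space differences of `Φ_{0,0}(ω,E)` is the same space difference of
`Φ_{k,0}(ω,E)` — then `norm_spaceDiff_uvMixedFn_le` at each frequency of `[ω₀, ω₀ + a h₀]`, where `max(|ω|,Λ/2) ≥ max(|ω₀| - a h₀, Λ/2)`).
[cite: BenfattoGiulianiMastropietro2006, Lemma 2.2 and (2.36aa)] -/
theorem norm_mixedDiff_uvSymbolOneFn_le (hΛ : 0 < Λ) (hD : 0 ≤ D)
    (hEs : ∀ s t, HasDerivAt (fun s' => E s' t) (Es s t) s) (hEt : ∀ s t, HasDerivAt (fun t' => E s t') (Et s t) t)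
    (hEst : ∀ s t, HasDerivAt (fun t' => Es s t') (Est s t) t)
    (bEs : ∀ s t, |Es s t| ≤ D) (bEt : ∀ s t, |Et s t| ≤ D) (bEst : ∀ s t, |Est s t| ≤ D)
    (a : ℕ) {b c : ℕ} (hb : b ≤ 1) (hc : c ≤ 1) {h₀ h : ℝ} (hh₀ : 0 ≤ h₀) (hh : 0 ≤ h) (ω₀ : ℝ) :
    ‖(fwdDiff h₀)^[a] (fun ω => (fwdDiff h)^[b] (fun s => (fwdDiff h)^[c] (fun t => uvSymbolOneFn Λ (ω, E s t)) 0) 0) ω₀‖ ≤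
      h₀ ^ a * h ^ (b + c) *
        (uvSurfaceConst Λ D a (b + c) / max (|ω₀| - a * h₀) (Λ / 2) ^ (a + min (b + c) 1 + 1)) := by
  -- the chain `g k ω = Δ_h^b Δ_h^c Φ_{k,0}(ω, E)`
  set g : ℕ → ℝ → ℂ := fun k ω => (fwdDiff h)^[b] (fun s => (fwdDiff h)^[c] (fun t => uvMixedFn Λ k 0 (ω, E s t)) 0) 0
    with hg
  have hg0 : (fun ω => (fwdDiff h)^[b] (fun s => (fwdDiff h)^[c] (fun t => uvSymbolOneFn Λ (ω, E s t)) 0) 0) = g 0 := by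
    simp only [hg, uvMixedFn_zero_zero]
  have hder : ∀ (k : ℕ) (ω : ℝ), HasDerivAt (g k) (g (k + 1) ω) ω := by
    intro k ω
    have hin : ∀ s, HasDerivAt (fun ω' => (fwdDiff h)^[c] (fun t => uvMixedFn Λ k 0 (ω', E s t)) 0)
        ((fwdDiff h)^[c] (fun t => uvMixedFn Λ (k + 1) 0 (ω, E s t)) 0) ω := fun s =>
      hasDerivAt_fwdDiff_iter_param c (F := fun ω' t => uvMixedFn Λ k 0 (ω', E s t))
        (F' := fun ω' t => uvMixedFn Λ (k + 1) 0 (ω', E s t)) (fun t => hasDerivAt_uvMixedFn_fst hΛ k ω (E s t)) 0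
    exact hasDerivAt_fwdDiff_iter_param b (F := fun ω' s => (fwdDiff h)^[c] (fun t => uvMixedFn Λ k 0 (ω', E s t)) 0)
      (F' := fun ω' s => (fwdDiff h)^[c] (fun t => uvMixedFn Λ (k + 1) 0 (ω', E s t)) 0) hin 0
  set mS := max (|ω₀| - a * h₀) (Λ / 2) with hmS
  have hmS0 : 0 < mS := lt_max_of_lt_right (by positivity)
  have hS := uvSurfaceConst_nonneg hΛ hD a (b + c)
  have hB : ∀ ω ∈ Icc ω₀ (ω₀ + a * h₀), ‖g a ω‖ ≤
      h ^ (b + c) * (uvSurfaceConst Λ D a (b + c) / mS ^ (a + min (b + c) 1 + 1)) := by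
    intro ω hω
    refine (norm_spaceDiff_uvMixedFn_le hΛ hD hEs hEt hEst bEs bEt bEst a hb hc hh ω).trans ?_
    have hmt : mS ≤ max |ω| (Λ / 2) := by
      refine max_le_max ?_ le_rfl
      have h1 : |ω₀| ≤ |ω| + |ω₀ - ω| := by
        have := abs_add_le ω (ω₀ - ω); rwa [add_sub_cancel] at this
      have h2 : |ω₀ - ω| ≤ a * h₀ := by
        rw [abs_sub_comm, abs_of_nonneg (by linarith [hω.1])]; linarith [hω.2]
      linarith
    exact mul_le_mul_of_nonneg_left (div_le_div_of_nonneg_left hS (pow_pos hmS0 _) (pow_le_pow_left₀ hmS0.le hmt _))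
      (by positivity)
  rw [hg0]
  have hmain := Literature.Analysis.norm_fwdDiff_iter_le_of_hasDerivAt (E := ℂ) hh₀ a g ω₀ _
    (fun k _ ω _ => hder k ω) hB
  simpa only [mul_assoc] using hmain

end Surface

end Literature.MathematicalPhysics.QuantumLattice

end
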